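/-
Copyright: cell pub-balaban-gaps, seat ne8 (estimate NE7c), gen 17. Project licence.
-/
import Summits.QuantumFields.BalabanUV.T4Continuum.Spine.NE7c.LiveFactorSUNTraceWindowConstant
import Summits.QuantumFields.BalabanUV.T4Continuum.Spine.NE7b.CompactFibrePlaquetteMassSUNLimit

/-!
# THE ONE-PLAQUETTE CONSTANT OF `SU(N)` FOR EVERY `N ≥ 2`: `(√β)^{N²−1} · ∫ e^{−β Re tr(1−V)} dHaar_{SU(N)}(V) → K_N` and `−log Z_N(β) − ((N²−1)∕2) log β → −log K_N`,
# **`K_N = ∏_{j<N} j! ∕ (√N·(2π)^{(N−1)∕2}) = G(N+1) ∕ (√N·(2π)^{(N−1)∕2})`** (Barnes `G`) — ne6's V48 ABELIAN theorems with their hypothesis DISCHARGED by this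
# seat's `LiveFactorSUNTraceWindowConstant`, and the constant's closed form collected (row NE7c, (vi′) corollary; [folklore])

Cell `pub-balaban-gaps` (G2), seat ne8, estimate **NE7c**.  Proof-only file under `Spine/NE7c/`: imports this seat's `LiveFactorSUNTraceWindowConstant` and ne6's V48
`Spine/NE7b/CompactFibrePlaquetteMassSUNLimit` (`tendsto_scaled_plaquetteMass_SUN_of_window`, `tendsto_freeEnergy_constant_SUN_of_window`), BY NAME.  No `def`; 0 `sorry`.
* §1 **`tendsto_scaled_plaquetteMass_SUN_valued`**, **`tendsto_freeEnergy_constant_SUN_valued`** (`N ≥ 2`; the limit constant in V48's native form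
  `(√2)^{N²−1}·C₀(N)·Γ((N²−1)∕2+1)`, = `LiveFactorSUNTraceWindowConstant.plaquetteMass_const_eq`'s product form; `K_2 = 1∕(2√π)`, `K_3 = 1∕(√3·π)` there).
* §2 (the constant COLLECTED by file 45's `plaquetteMass_const_barnes` to the Barnes `G`-value `∏_{j<N} j! ∕ (√N·(2π)^{(N−1)∕2})`, BY NAME)
  **`tendsto_scaled_plaquetteMass_SUN_barnes`**:
  `(√β)^{N²−1}·Z_N(β) → ∏_{j<N} j! ∕ (√N·(2π)^{(N−1)∕2})` and **`tendsto_freeEnergy_constant_SUN_barnes`** (`N ≥ 2`).  Values: `K_2 = 1∕(2√π) = 0.2821`,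
  `K_3 = 1∕(√3·π) = 0.1838`, `K_4 = 6∕(2π)^{3∕2} = 0.3810`, `K_5 = 288∕(√5·(2π)²) = 3.263`, `K_6 = 34560∕(√6·(2π)^{5∕2}) = 142.6` — super-exponential growth
  `G(N+1)`, as the Gaussian (tangent-space) heuristic `Z_N(β) ≈ vol_HS(SU(N))⁻¹·(2π∕β)^{(N²−1)∕2}` with `vol_HS SU(N) = √N(2π)^{(N²+N−2)∕2}∕G(N+1)` predicts.

HONEST: Laplace asymptotics of one compact-group integral ([folklore]); nothing of the interacting measure, nothing of Bałaban's; census-neutral.  NE7c NOT proved; WORD UNCHANGED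
(WORK-bound behind node O; INSTANCE 0∕1); spine 0∕9; one finite T⁴ — NOT ℝ⁴, NOT infinite volume, NOT the mass gap, NOT Clay.
-/

set_option autoImplicit false

noncomputable section

open scoped Matrix.Norms.Frobenius Real Topology
open MeasureTheory Set Filter
open Literature.MathematicalPhysics.QuantumFieldTheory (haarProbability)
open Literature.MathematicalPhysics.QuantumFieldTheory.UnitaryCayley (haarChartConst)
open Literature.MathematicalPhysics.QuantumFieldTheory.UnitaryColumn (haarChartConst_eq)
open Summit.QuantumFields.BalabanUV.T4Continuum.Spine.NE7c.LiveFactorSUNTraceWindowConstant (tendsto_haar_traceWindow_div_sqrt_pow_valued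
  plaquetteMass_const_barnes)
open Summit.QuantumFields.BalabanUV.T4Continuum.NE7b.CompactFibrePlaquetteMassSUNLimit (tendsto_scaled_plaquetteMass_SUN_of_window
  tendsto_freeEnergy_constant_SUN_of_window)

namespace Summit.QuantumFields.BalabanUV.T4Continuum.Spine.NE7c.LiveFactorSUNPlaquetteMassConstant

variable {N : ℕ}

/-- **THE ONE-PLAQUETTE CONSTANT OF `SU(N)` VALUED** (`N ≥ 2`; V48's hypothesis discharged):
`(√β)^{N²−1} · ∫ e^{−β Re tr(1−V)} dHaar_{SU(N)}(V) → (√2)^{N²−1}·C₀(N)·Γ((N²−1)∕2 + 1)` as `β → ∞`. [folklore] -/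
theorem tendsto_scaled_plaquetteMass_SUN_valued (hN : 2 ≤ N) :
    Tendsto (fun β : ℝ => Real.sqrt β ^ (N ^ 2 - 1) *
        ∫ V, Real.exp (-(β * (Matrix.trace (1 - (V : Matrix (Fin N) (Fin N) ℂ))).re)) ∂(haarProbability (Matrix.specialUnitaryGroup (Fin N) ℂ)))
      atTop (𝓝 (Real.sqrt 2 ^ (N ^ 2 - 1) * ((haarChartConst N : ℝ) * (2 * Real.sqrt N * (π / N)) *
        (Real.sqrt π ^ (N * N - 1) / Real.Gamma ((N * N - 1 : ℕ) / 2 + 1))) * Real.Gamma (((N ^ 2 - 1 : ℕ) : ℝ) / 2 + 1))) :=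
  tendsto_scaled_plaquetteMass_SUN_of_window (tendsto_haar_traceWindow_div_sqrt_pow_valued hN)

/-- **THE FREE-ENERGY CONSTANT VALUED** (`N ≥ 2`): `−log Z_N(β) − ((N²−1)∕2)·log β → −log K_N`, `K_N` the valued one-plaquette constant. [folklore] -/
theorem tendsto_freeEnergy_constant_SUN_valued (hN : 2 ≤ N) :
    Tendsto (fun β : ℝ =>
        -Real.log (∫ V, Real.exp (-(β * (Matrix.trace (1 - (V : Matrix (Fin N) (Fin N) ℂ))).re)) ∂(haarProbability (Matrix.specialUnitaryGroup (Fin N) ℂ)))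
          - (((N ^ 2 - 1 : ℕ) : ℝ)) / 2 * Real.log β)
      atTop (𝓝 (-Real.log (Real.sqrt 2 ^ (N ^ 2 - 1) * ((haarChartConst N : ℝ) * (2 * Real.sqrt N * (π / N)) *
        (Real.sqrt π ^ (N * N - 1) / Real.Gamma ((N * N - 1 : ℕ) / 2 + 1))) * Real.Gamma (((N ^ 2 - 1 : ℕ) : ℝ) / 2 + 1)))) := by
  haveI : NeZero N := ⟨by omega⟩
  have hN0 : (0 : ℝ) < N := Nat.cast_pos.2 (Nat.pos_of_ne_zero (NeZero.ne N))
  have hc : 0 < (haarChartConst N : ℝ) := by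
    rw [haarChartConst_eq]
    exact div_pos (Finset.prod_pos fun j _ => by exact_mod_cast Nat.factorial_pos j) (by positivity)
  have hpos : 0 < Real.sqrt 2 ^ (N ^ 2 - 1) * ((haarChartConst N : ℝ) * (2 * Real.sqrt N * (π / N)) *
      (Real.sqrt π ^ (N * N - 1) / Real.Gamma ((N * N - 1 : ℕ) / 2 + 1))) := by
    have h1 : 0 < Real.Gamma ((N * N - 1 : ℕ) / 2 + 1) := Real.Gamma_pos_of_pos (by positivity)
    have h2 : 0 < Real.sqrt N := Real.sqrt_pos.2 hN0
    have h3 : 0 < Real.sqrt π := Real.sqrt_pos.2 Real.pi_pos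
    positivity
  exact tendsto_freeEnergy_constant_SUN_of_window hpos (tendsto_haar_traceWindow_div_sqrt_pow_valued hN)

/-! ## §2 The law with its constant as a Barnes `G`-value (`LiveFactorSUNTraceWindowConstant.plaquetteMass_const_barnes`, BY NAME) -/

/-- **THE `β^{−(N²−1)∕2}` LAW OF `SU(N)` WITH ITS CONSTANT AS A BARNES `G`-VALUE** (`N ≥ 2`):
`(√β)^{N²−1} · ∫ e^{−β Re tr(1−V)} dHaar_{SU(N)}(V) → ∏_{j<N} j! ∕ (√N·(2π)^{(N−1)∕2})` as `β → ∞`. [folklore] -/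
theorem tendsto_scaled_plaquetteMass_SUN_barnes (hN : 2 ≤ N) :
    Tendsto (fun β : ℝ => Real.sqrt β ^ (N ^ 2 - 1) *
        ∫ V, Real.exp (-(β * (Matrix.trace (1 - (V : Matrix (Fin N) (Fin N) ℂ))).re)) ∂(haarProbability (Matrix.specialUnitaryGroup (Fin N) ℂ)))
      atTop (𝓝 ((∏ j ∈ Finset.range N, (j.factorial : ℝ)) / (Real.sqrt N * (2 * π) ^ (((N : ℝ) - 1) / 2)))) := by
  have h := tendsto_scaled_plaquetteMass_SUN_valued hN
  rwa [plaquetteMass_const_barnes (by omega)] at h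

/-- **THE FREE-ENERGY CONSTANT AS A BARNES `G`-VALUE** (`N ≥ 2`): `−log Z_N(β) − ((N²−1)∕2)·log β → −log (∏_{j<N} j! ∕ (√N·(2π)^{(N−1)∕2}))`. [folklore] -/
theorem tendsto_freeEnergy_constant_SUN_barnes (hN : 2 ≤ N) :
    Tendsto (fun β : ℝ =>
        -Real.log (∫ V, Real.exp (-(β * (Matrix.trace (1 - (V : Matrix (Fin N) (Fin N) ℂ))).re)) ∂(haarProbability (Matrix.specialUnitaryGroup (Fin N) ℂ)))
          - (((N ^ 2 - 1 : ℕ) : ℝ)) / 2 * Real.log β)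
      atTop (𝓝 (-Real.log ((∏ j ∈ Finset.range N, (j.factorial : ℝ)) / (Real.sqrt N * (2 * π) ^ (((N : ℝ) - 1) / 2))))) := by
  have h := tendsto_freeEnergy_constant_SUN_valued hN
  rwa [plaquetteMass_const_barnes (by omega)] at h

end Summit.QuantumFields.BalabanUV.T4Continuum.Spine.NE7c.LiveFactorSUNPlaquetteMassConstant
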